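import Summits.CriticalPhenomena.PercolationContinuityZ3.Theorems.Transplant.SkelFrmBChoiceAtQ
import HarnessLib

/-!
# N2 (frames-only node `SamePDropOfSkeletonFrm₁`, OPEN), WAVE 1: THE LONG LINKS AT EVERY CENTRE IN THE LITERAL BINDER SHAPE OF THE (S0) LEGS —
# `NegB.hlong_of_atQ3` / `NegB.hlongY_of_atQ3` (the `hlong` / `hlongY` rows of `reachOblAtHNF_of_kgCorr(E/EC)` and `rootChainF_of_kgCorr(E/EC)`)

At the premise `AtQNQ` of the choices of record `NegB.choiceAtQ3 …` (Defs3 p349149; Step-I‴ accuracy `δI3 = δkit³/16`, (R-33)), for every `a ≥ δkit` (e.g. `a := κ.δr 0` by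
`Neg.δkit_le_δr κ Φ (n := 0)`), every centre `c` and every sign `τ = ±1`:
`1 − a³ < P_q(linkIn (pgramPrism G φL c nL hL (3ℓL) RL) (O.merged.Λ c (Mu O.merged)) (pgSideHalfW G φL c nL hL ℓL RL 1 (1·τ)))` and the same for the top piece
`pgTopPieceW … 1 τ vL` — i.e. the `hlong`/`hlongY` binders VERBATIM at `(φ, n, hs, ℓ, Rl, v, σ, Λc, kz) := (φL, nL, hL, ℓL, RL, vL, 1, O.merged.Λ, Mu O.merged)` with
**`NegB.RL := O.merged.R (O.merged.scale t ML nL)`** (the long link region's prism radius).  Three steps over stmt-g20's `inputsLAt_of_atQ` (SkelFrmBChoiceAtQ p350211 ✓): unfold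
`eventNAt` (the long data `hL/ℓL/vL` ARE the record's `hgt/len/spl` at the long pair, by `rfl`); the cube `δI3 ≤ a³` (`NegB.δI3_le_cube_of_le`); and ONE monotonicity
step in the seed — Step I‴ serves the link from the zone at the SEED LEVEL `k`, the kit rows read the zone at `M_u`, and `Λ c k ⊆ Λ c M_u` because the record's zones are
the NESTED fat seeds (`FactsO.seed`: `Λ = fatSeq`, `k ≤ M₀ ≤ M_u`; `fatSeq_subset_fatSeq`, `linkIn_mono`) — design note p3-g16 2026-08-23T03:20:34Z.
builds on p205010 (kernel theorem, internal audit signed; external expert review pending) — nothing in this file uses p205010; NOTHING is claimed about the open node.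
Lane `prim-bschramm`, seat `prim-bschramm-p3` (gen 16; N2 design owner); helper file (`--supports stmt-CriticalPhenomena-4575 --as helper`).
[cite: KozmaNitzan2024, §4 pp. 19–21 ((21)–(25): the inputs at every vertex), p. 28 ((32))] [cite: MartineauTassion2017, §3.2 Lemma 3.5]
-/

noncomputable section

open scoped Classical

namespace Summit.CriticalPhenomena.PercolationContinuityZ3.Theorems.Transplant

open MeasureTheory Literature.Probability.Percolation Literature.Probability.LatticeModels SimpleGraph KNCells KNLevels
open Literature.Barriers.CriticalPhenomena (HasExponentialGrowth)

namespace PlanarSkeletonFrm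

open SkelConc (Consts)
open Skelφ (oriφ trφ)
open Skelφ.StepI (DataN DataNS OutNS)

namespace NegB

open Neg

/-- **The long link region's prism radius** `RL := R(scale(t, M_L, n_L))` of the merged record (the `Rl` of the (S0) legs). [this work] -/
def RL (κ : Consts) {V : Type} [DecidableEq V] [Countable V] {G : SimpleGraph V} [G.LocallyFinite] (Φ : PlanarSkeletonFrm G) (t : V) (p : unitInterval) (O : OutNS V)
    (gv fv : Neg.FSlot) : ℕ :=
  O.merged.R (O.merged.toDataN.scale t (ML κ Φ t p O.merged (gOf κ Φ t p O gv)) (nL κ Φ t p O.merged (gOf κ Φ t p O gv) (fOf κ Φ t p O fv)))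

section Links

variable {κ : Consts} {V : Type} [DecidableEq V] [Countable V] {G : SimpleGraph V} [G.LocallyFinite] {Φ : PlanarSkeletonFrm G} {t : V} {p : unitInterval}
  {hC : Φ.CylSubcritical p} {gv fv : Neg.FSlot} {Pv : PSlot} {Sv : SSlot} {cv : CSlot} {bv : BSlot} {O : OutNS V} {q : unitInterval}


/-- The zone at the seed level lies in the zone at `M_u` (nested fat seeds, `k ≤ M₀ ≤ M_u`). [folklore] -/
theorem zone_k_subset_zone_Mu (hAt : (choiceAtQ3 κ Φ t p Pv gv fv Sv cv bv hC).AtQNQ O q) (c : V) :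
    O.merged.Λ c O.merged.k ⊆ O.merged.Λ c (Mu O.merged) := by
  obtain ⟨-, -, hkM₀, -, hΛeq⟩ := Skelφ.StepI.OutO.FactsO.seed hAt.1.factsO
  have hk : O.merged.Λ c O.merged.k = Skelφ.fatSeq Φ.frame hC c O.merged.k := by
    have := congrFun (congrFun hΛeq c) O.merged.k; exact this
  have hM : O.merged.Λ c (Mu O.merged) = Skelφ.fatSeq Φ.frame hC c (Mu O.merged) := by
    have := congrFun (congrFun hΛeq c) (Mu O.merged); exact this
  rw [hk, hM]
  exact Skelφ.Eq.fatSeq_subset_fatSeq Φ.frame hC c (k_le_Mu O.merged hkM₀)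

/-- **`hlong` AT EVERY CENTRE, LITERAL SHAPE**: the long pair's side-half links at accuracy `1 − a³` (`a ≥ δkit`), zone at `M_u`, served sign `σ = 1`.
[cite: KozmaNitzan2024, §4 pp. 19–21] -/
theorem hlong_of_atQ3 (hAt : (choiceAtQ3 κ Φ t p Pv gv fv Sv cv bv hC).AtQNQ O q) (h1 : Φ.types = {t}) {a : ℝ} (ha : Neg.δkit κ Φ ≤ a) :
    ∀ (c : V) (τ : ℤ), τ = 1 ∨ τ = -1 → 1 - a ^ 3 < (bondPercolation G q).real
      (linkIn (Skelφ.pgramPrism G (φL κ Φ t p O.D O.DT.toDataN O.ori (gOf κ Φ t p O gv) (fOf κ Φ t p O fv)) c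
          (nL κ Φ t p O.merged (gOf κ Φ t p O gv) (fOf κ Φ t p O fv)) (hL κ Φ t p O.merged (gOf κ Φ t p O gv) (fOf κ Φ t p O fv))
          (3 * ℓL κ Φ t p O.merged (gOf κ Φ t p O gv) (fOf κ Φ t p O fv)) (RL κ Φ t p O gv fv))
        (O.merged.Λ c (Mu O.merged))
        (Skelφ.pgSideHalfW G (φL κ Φ t p O.D O.DT.toDataN O.ori (gOf κ Φ t p O gv) (fOf κ Φ t p O fv)) c
          (nL κ Φ t p O.merged (gOf κ Φ t p O gv) (fOf κ Φ t p O fv)) (hL κ Φ t p O.merged (gOf κ Φ t p O gv) (fOf κ Φ t p O fv))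
          (ℓL κ Φ t p O.merged (gOf κ Φ t p O gv) (fOf κ Φ t p O fv)) (RL κ Φ t p O gv fv) 1 (1 * τ))) := by
  intro c τ hτ
  obtain ⟨τu, hτu⟩ : ∃ τu : ℤˣ, (τu : ℤ) = τ := by
    rcases hτ with rfl | rfl
    · exact ⟨1, Units.val_one⟩
    · exact ⟨-1, by simp⟩
  have h := inputsLAt_of_atQ hAt h1 c 0 τu
  rw [Skelφ.StepI.eventNAt_some] at h
  unfold Skelφ.StepI.regionNAt Skelφ.StepI.pieceNAt at h
  rw [if_pos rfl, Units.val_one, hτu] at h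
  rw [one_mul]
  have hcube := δI3_le_cube_of_le κ Φ ha
  refine lt_of_le_of_lt (by linarith) (h.trans_le (measureReal_mono ?_ (measure_ne_top _ _)))
  exact linkIn_mono le_rfl (zone_k_subset_zone_Mu hAt c) subset_rfl

/-- **`hlongY` AT EVERY CENTRE, LITERAL SHAPE**: the long pair's top-piece links at accuracy `1 − a³`, zone at `M_u`, served sign `σ = 1`, split point `vL`.
[cite: KozmaNitzan2024, §4 pp. 19–21] -/
theorem hlongY_of_atQ3 (hAt : (choiceAtQ3 κ Φ t p Pv gv fv Sv cv bv hC).AtQNQ O q) (h1 : Φ.types = {t}) {a : ℝ} (ha : Neg.δkit κ Φ ≤ a) :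
    ∀ (c : V) (τ : ℤ), τ = 1 ∨ τ = -1 → 1 - a ^ 3 < (bondPercolation G q).real
      (linkIn (Skelφ.pgramPrism G (φL κ Φ t p O.D O.DT.toDataN O.ori (gOf κ Φ t p O gv) (fOf κ Φ t p O fv)) c
          (nL κ Φ t p O.merged (gOf κ Φ t p O gv) (fOf κ Φ t p O fv)) (hL κ Φ t p O.merged (gOf κ Φ t p O gv) (fOf κ Φ t p O fv))
          (3 * ℓL κ Φ t p O.merged (gOf κ Φ t p O gv) (fOf κ Φ t p O fv)) (RL κ Φ t p O gv fv))
        (O.merged.Λ c (Mu O.merged))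
        (Skelφ.pgTopPieceW G (φL κ Φ t p O.D O.DT.toDataN O.ori (gOf κ Φ t p O gv) (fOf κ Φ t p O fv)) c
          (nL κ Φ t p O.merged (gOf κ Φ t p O gv) (fOf κ Φ t p O fv)) (hL κ Φ t p O.merged (gOf κ Φ t p O gv) (fOf κ Φ t p O fv))
          (ℓL κ Φ t p O.merged (gOf κ Φ t p O gv) (fOf κ Φ t p O fv)) (RL κ Φ t p O gv fv) 1 τ
          (vL κ Φ t p O.merged (gOf κ Φ t p O gv) (fOf κ Φ t p O fv)))) := by
  intro c τ hτ
  obtain ⟨τu, hτu⟩ : ∃ τu : ℤˣ, (τu : ℤ) = τ := by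
    rcases hτ with rfl | rfl
    · exact ⟨1, Units.val_one⟩
    · exact ⟨-1, by simp⟩
  have h := inputsLAt_of_atQ hAt h1 c 1 τu
  rw [Skelφ.StepI.eventNAt_some] at h
  unfold Skelφ.StepI.regionNAt Skelφ.StepI.pieceNAt at h
  rw [if_neg (by decide), Units.val_one, hτu] at h
  have hcube := δI3_le_cube_of_le κ Φ ha
  refine lt_of_le_of_lt (by linarith) (h.trans_le (measureReal_mono ?_ (measure_ne_top _ _)))
  exact linkIn_mono le_rfl (zone_k_subset_zone_Mu hAt c) subset_rfl

end Links

end NegB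

end PlanarSkeletonFrm

end Summit.CriticalPhenomena.PercolationContinuityZ3.Theorems.Transplant

end
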